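import Summits.CriticalPhenomena.CardyFormulaZ2.Theses.CardyPolygonWords
import Literature.Probability.LatticeModels.PercolationPolygonWordProofs

/-!
# Birth skeleton (BC3) for crux `CardyLatticePolygon` (stmt-CriticalPhenomena-4781)

Route `CardyPolygonWords` (route-CriticalPhenomena-CardyPolygonWords), sub-problem `CardyFormulaZ2`,
crux (rank 0, ex-target, auto-crux):

  `CardyLatticePolygon` — Cardy's formula (bond-`ℤ²`, `p = 1/2`, G02 discretisation
  `bondDomainCrossingProb`, limit `cardyFunction (crossRatio x)` as the mesh `δ → 0⁺`) for every
  conformal rectangle whose carrier is an open POLYOMINO (interior of a finite union of closed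
  `δ₀`-squares) and whose four marks are `δ₀`-lattice points.

## The line (polygons are words: aligned-mesh word scaling limit + RSW mesh rounding)

The route's mechanism lives at ALIGNED meshes `δ = δ₀ / N`: there, and only there, the G02
crossing probability of a lattice polygon IS the amplitude `⟨β| T … J … wire … T |α⟩` of its
transfer-matrix word (stochastic Temperley–Lieb(β = 1) row transfer matrices of varying width,
junction letters, wire letters).  This dictionary is no longer a hope: the word vocabulary landed
(`Literature.Probability.LatticeModels.PercolationPolygonWord`: `polygonWordAmplitude`,
`polyominoCarrier`) and the named fact `RowTransferExactness` is DISCHARGED in the tree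
(`Literature.Probability.LatticeModels.RowTransferExactness_holds`,
`PercolationPolygonWordProofs.lean`).  The crux therefore splits along the honest seam
"aligned meshes (algebra of words) / all meshes (RSW)":

* `stub_wordScalingLimit` (XL, LOAD-BEARING — the word mechanism proper): for a polyomino
  conformal rectangle with lattice marks and every uniformizing datum `(φ, x)`, the WORD AMPLITUDES
  along the aligned meshes converge: `polygonWordAmplitude R (δ₀ / N) → cardyFunction (crossRatio x)`
  as `N → ∞`.  This is a statement about limits of matrix elements of products of explicit finite
  stochastic matrices (the route's TRANSFER: rectangle data = TL(β=1) conformal towers and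
  boundary overlaps — crux `CardyRectangle` read through the dictionary —, plus the scaling limit
  of the junction overlaps — crux `CardyOneStep` / informal `JunctionOverlapLimit` —, sewn along
  the word — crux `WordSewing`).  No probability beyond the dictionary is left in it.
* `stub_meshRounding` (M–L, RSW technology, F-free and limit-free): for a polyomino conformal
  rectangle the crossing probability at a general mesh `δ` is asymptotically that at the rounded
  ALIGNED mesh `δ₀ / ⌈δ₀/δ⌉₊`: for every `ε > 0`, eventually as `δ → 0⁺`,
  `|bond R δ − bond R (δ₀ / ⌈δ₀/δ⌉₊)| ≤ ε`.  Intended proof: exact dilation covariance of the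
  G02 discretisation (`meshPoint` is linear: `bond (μ • R) (μ δ') = bond R δ'`, `MarkedDomain.map`
  by the homothety `μ = δ'/δ → 1`) reduces it to Schramm–Smirnov quad-continuity at a FIXED mesh
  between `R` and its homothetic copy `μ • R`, `μ ∈ [1 − δ/δ₀, 1]`, uniformly in small meshes
  (SchrammSmirnov2011 Lemma 5.1 / 6.1 from RSW alone; tree: `rsw_half_holds`, the two-sided
  sandwich lemmas of `Theorems/CardyBoundaryCoulombGasRectilinearSuffices{Lower,Upper}Sandwich.lean`,
  `…Mixed.lean`, `exists_latticePolygon_close`, `discreteCrossing_subset_of_lower`).  It is needed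
  by ANY proof through words (in particular by the route's glue crux `WordSewing`), is implied by
  the crux (both terms tend to `F(η)`), and does not imply it.
* `CardyLatticePolygon_of` (kernel-checked, no `sorry`): fix `R`, the polyomino data `(δ₀, s)`,
  lattice marks, a uniformizing datum `(φ, x)` and `e > 0`; the word limit gives `N₀` with
  `|word R (δ₀/N) − F(η)| < e/2` for `N ≥ N₀`; the DISCHARGED dictionary
  `RowTransferExactness_holds` rewrites `word R (δ₀/N) = bond R (δ₀/N)` (`N ≥ 1`); mesh rounding
  gives `|bond R δ − bond R (δ₀/⌈δ₀/δ⌉₊)| ≤ e/2` eventually; and `⌈δ₀/δ⌉₊ ≥ N₀` once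
  `δ < δ₀/(N₀+1)`.  Triangle inequality.

Hardest stub: `stub_wordScalingLimit` (it carries the open content of the crux, in word language,
along aligned meshes only).  Neither stub is the crux or the summit in costume: stub 1 speaks of
word amplitudes along an `ℕ`-indexed mesh sequence (no `HasCrossingLimit`, no `𝓝[>] 0` filter, no
`bondDomainCrossingProb`), stub 2 names no limit value at all; the BC3 probes
`stub → CardyLatticePolygon`, `stub → CardyFormulaZ2` by `first | exact? | simpa | aesop` fail 4/4
(planner folder `bc/CardyLatticePolygon_probe.lean`).

## Disproof used / negatives
`ledger crux ls stmt-CriticalPhenomena-4781`: no workfiles before this one — no `Disproof.lean`, no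
`_false_without_` obstruction to honour, no landed `Theorems/CardyLatticePolygon/Negative/` lemma to
import.  `ledger negatives --problem CriticalPhenomena` (11 entries, 2026-08-17): no stub is an
instance.  Relevant neighbours: `NegDegenerateArcs` (stmt-0748, refuted `∃ R, ∃ᶠ δ, bond R δ = 0`)
supports non-degeneracy and is consistent with both stubs; `JunctionShadowing` (stmt-8581,
CardyGluingRDE, refuted-misstated through the `≤` tie rule of `discreteArc`) concerns seam gluing
of coarse boundary segments — the word dictionary used here keeps G02's tie rule untouched
(`polygonWordAmplitude` wires a vertex on both discrete arcs to both stars, exactly as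
`discreteCrossing`), and `RowTransferExactness_holds` is an equality proved with that convention, so
the witness of 8581 does not touch the stubs (stub 1 is about opposite arcs 0/2 in the limit,
stub 2 compares the same event at two meshes).
-/

noncomputable section

open Set Filter Topology Metric
open UpperHalfPlane (upperHalfPlaneSet)
open Literature.Probability.RandomPlanarGeometry
open Literature.Probability.Percolation (bondDomainCrossingProb)
open Literature.Probability.LatticeModels (polygonWordAmplitude polyominoCarrier
  RowTransferExactness RowTransferExactness_holds)

namespace Summit.CriticalPhenomena.CardyFormulaZ2.Cruxes.CardyLatticePolygon.Birth

/-! ### The two statements of the line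

Each statement is a precise `Prop` (`WordScalingLimit`, `MeshRounding`), restated VERBATIM by its
registered `theorem stub_… := by sorry` below (the only `sorry`s of the file) and aliased under the
stub's short name in the namespace `Registered` (the skeleton audit `#h21_check_skeleton` admits the
hypotheses of the composition BY NAME: registered obligations or declared stubs);
`registered_of_stubs` inhabits the aliases by the stubs literally, which checks that statements,
aliases and stubs agree. -/

/-- STATEMENT 1 — **word scaling limit along aligned meshes** (see `stub_wordScalingLimit`). -/
def WordScalingLimit : Prop :=
  ∀ (R : Literature.Probability.RandomPlanarGeometry.ConformalRectangle) (δ₀ : ℝ)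
    (s : Finset (ℤ × ℤ)), 0 < δ₀ →
    R.carrier = Literature.Probability.LatticeModels.polyominoCarrier δ₀ s →
    (∀ i, ∃ m n : ℤ, R.pt i = (δ₀ : ℂ) * ((m : ℂ) + (n : ℂ) * Complex.I)) →
    ∀ (φ : Literature.Probability.RandomPlanarGeometry.ConformalEquiv
        UpperHalfPlane.upperHalfPlaneSet R.carrier) (x : Fin 4 → ℝ), R.IsUniformizing φ x →
      Filter.Tendsto
        (fun N : ℕ => Literature.Probability.LatticeModels.polygonWordAmplitude R (δ₀ / (N : ℝ)))
        Filter.atTop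
        (nhds (Literature.Probability.RandomPlanarGeometry.cardyFunction
          (Literature.Probability.RandomPlanarGeometry.crossRatio x)))

/-- STATEMENT 2 — **mesh rounding** (see `stub_meshRounding`). -/
def MeshRounding : Prop :=
  ∀ (R : Literature.Probability.RandomPlanarGeometry.ConformalRectangle) (δ₀ : ℝ)
    (s : Finset (ℤ × ℤ)), 0 < δ₀ →
    R.carrier = Literature.Probability.LatticeModels.polyominoCarrier δ₀ s →
    (∀ i, ∃ m n : ℤ, R.pt i = (δ₀ : ℂ) * ((m : ℂ) + (n : ℂ) * Complex.I)) →
    ∀ ε : ℝ, 0 < ε → ∀ᶠ δ : ℝ in nhdsWithin 0 (Set.Ioi 0),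
      |Literature.Probability.Percolation.bondDomainCrossingProb R δ -
          Literature.Probability.Percolation.bondDomainCrossingProb R (δ₀ / (⌈δ₀ / δ⌉₊ : ℝ))| ≤ ε

/-! ### The registered stubs `stub_…` (the only `sorry`s of the file) -/

/-- **STUB 1 — word scaling limit along aligned meshes** (XL; the load-bearing stub).  For a
conformal rectangle `R` whose carrier is the open polyomino `polyominoCarrier δ₀ s` and whose four
marks are `δ₀`-lattice points, and every uniformizing datum `(φ, x)` of `R`, the transfer-matrix
word amplitudes along the aligned meshes converge to Cardy's value:
`polygonWordAmplitude R (δ₀ / N) → cardyFunction (crossRatio x)` as `N → ∞`.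
Why plausibly true: by the discharged dictionary `RowTransferExactness_holds` it is exactly Cardy's
formula for `R` along the mesh sequence `δ₀ / N`, i.e. a consequence of the crux (and of the
conjunct); as the word mechanism it is the route's thesis: rectangle words (TL(β = 1) / XXZ(Δ = −1/2)
conformal towers `h ∈ {0, 1/3, 1, 4/3, 2, …}` and boundary overlaps, Cardy 2001 §7, Kleban–Zagier)
plus the scaling limit of the junction overlaps (Dubail–Stéphan-type fidelities, Schwarz–Christoffel
vertex of the step) sewn along the word.  Size XL (open).
[cite: Cardy2001, §7.1] [cite: BondesanJacobsenSaleur2012, §5] [cite: Cardy1992, eq. (8)]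
[cite: SchrammSmirnov2011, Question 2] -/
theorem stub_wordScalingLimit :
    ∀ (R : Literature.Probability.RandomPlanarGeometry.ConformalRectangle) (δ₀ : ℝ)
      (s : Finset (ℤ × ℤ)), 0 < δ₀ →
      R.carrier = Literature.Probability.LatticeModels.polyominoCarrier δ₀ s →
      (∀ i, ∃ m n : ℤ, R.pt i = (δ₀ : ℂ) * ((m : ℂ) + (n : ℂ) * Complex.I)) →
      ∀ (φ : Literature.Probability.RandomPlanarGeometry.ConformalEquiv
          UpperHalfPlane.upperHalfPlaneSet R.carrier) (x : Fin 4 → ℝ), R.IsUniformizing φ x →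
        Filter.Tendsto
          (fun N : ℕ => Literature.Probability.LatticeModels.polygonWordAmplitude R (δ₀ / (N : ℝ)))
          Filter.atTop
          (nhds (Literature.Probability.RandomPlanarGeometry.cardyFunction
            (Literature.Probability.RandomPlanarGeometry.crossRatio x))) := by
  sorry

/-- **STUB 2 — mesh rounding** (M–L; RSW technology; F-free and limit-free).  For a conformal
rectangle `R` whose carrier is the open polyomino `polyominoCarrier δ₀ s` with `δ₀`-lattice marks
and every `ε > 0`: eventually as `δ → 0⁺`, the crossing probability at mesh `δ` differs by at most
`ε` from the one at the rounded ALIGNED mesh `δ₀ / ⌈δ₀ / δ⌉₊` (`≤ δ`, ratio `→ 1`).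
Why plausibly true: exact dilation covariance of the G02 discretisation (`meshPoint` is linear;
`MarkedDomain.map` by a homothety) turns it into quad-continuity at a fixed mesh between `R` and a
homothetic copy `μ • R`, `μ → 1`, uniform in small meshes, which follows from RSW alone
(Schramm–Smirnov 2011 Lemma 5.1 / §6; Bollobás–Riordan two-sided sandwiches, ported to bond-`ℤ²`
in the tree: `Theorems/CardyBoundaryCoulombGasRectilinearSuffices{Lower,Upper}Sandwich.lean`,
`…Mixed.lean`).  Size M–L.
[cite: SchrammSmirnov2011, Lemma 5.1 and §6] [cite: BollobasRiordan2006, Ch. 7 Lemma 14] -/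
theorem stub_meshRounding :
    ∀ (R : Literature.Probability.RandomPlanarGeometry.ConformalRectangle) (δ₀ : ℝ)
      (s : Finset (ℤ × ℤ)), 0 < δ₀ →
      R.carrier = Literature.Probability.LatticeModels.polyominoCarrier δ₀ s →
      (∀ i, ∃ m n : ℤ, R.pt i = (δ₀ : ℂ) * ((m : ℂ) + (n : ℂ) * Complex.I)) →
      ∀ ε : ℝ, 0 < ε → ∀ᶠ δ : ℝ in nhdsWithin 0 (Set.Ioi 0),
        |Literature.Probability.Percolation.bondDomainCrossingProb R δ -
            Literature.Probability.Percolation.bondDomainCrossingProb R (δ₀ / (⌈δ₀ / δ⌉₊ : ℝ))| ≤ ε := by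
  sorry

/-! ### Name-keyed aliases of the two statements (the hypotheses of the composition) -/
namespace Registered

/-- Alias of `WordScalingLimit` keyed by the registered stub name. -/
abbrev stub_wordScalingLimit : Prop := WordScalingLimit
/-- Alias of `MeshRounding` keyed by the registered stub name. -/
abbrev stub_meshRounding : Prop := MeshRounding

end Registered

/-- Consistency: each alias IS its stub's statement (definitionally) — the stubs inhabit the
aliases (its axiom closure contains `sorryAx` exactly through the two stubs; it is NOT a proof of
anything). [folklore] -/
theorem registered_of_stubs : Registered.stub_wordScalingLimit ∧ Registered.stub_meshRounding :=
  ⟨stub_wordScalingLimit, stub_meshRounding⟩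

/-! ### The composition (kernel-checked, no `sorry`) -/

/-- **Assembly**: the word scaling limit along aligned meshes and mesh rounding imply the crux
`CardyPolygonWords.CardyLatticePolygon`, through the DISCHARGED dictionary
`RowTransferExactness_holds` (`bond R (δ₀/N) = word R (δ₀/N)`, `N ≥ 1`).  Given the polyomino data,
a uniformizing datum `(φ, x)` and `e > 0`: `N₀` from the word limit at `e/2`, the rounding at `e/2`,
and `⌈δ₀/δ⌉₊ ≥ N₀` for `0 < δ < δ₀/(N₀+1)`; triangle inequality. [folklore] -/
theorem CardyLatticePolygon_of (hword : Registered.stub_wordScalingLimit)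
    (hround : Registered.stub_meshRounding) :
    Summit.CriticalPhenomena.CardyFormulaZ2.Theses.CardyPolygonWords.CardyLatticePolygon := by
  rintro R ⟨δ₀, hδ₀, ⟨s, hs⟩, hpt⟩ φ x hux
  have hcar : R.carrier = polyominoCarrier δ₀ s := hs
  rw [Metric.tendsto_nhds]
  intro e he
  have he2 : 0 < e / 2 := by positivity
  -- aligned meshes: the word amplitudes converge to `F η`
  obtain ⟨N₀, hN₀⟩ := Metric.tendsto_atTop.1 (hword R δ₀ s hδ₀ hcar hpt φ x hux) (e / 2) he2
  -- general meshes: rounding to the aligned mesh `δ₀ / ⌈δ₀/δ⌉₊`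
  have hr := hround R δ₀ s hδ₀ hcar hpt (e / 2) he2
  -- small meshes: `0 < δ < δ₀ / (N₀ + 1)`
  have hsmall : ∀ᶠ δ : ℝ in 𝓝[>] (0 : ℝ), δ ∈ Ioo (0 : ℝ) (δ₀ / ((N₀ : ℝ) + 1)) :=
    Ioo_mem_nhdsGT (by positivity)
  filter_upwards [hr, hsmall] with δ hrδ hδ
  obtain ⟨hδpos, hδlt⟩ := hδ
  have hq : 0 < δ₀ / δ := div_pos hδ₀ hδpos
  have hNpos : 0 < ⌈δ₀ / δ⌉₊ := Nat.ceil_pos.2 hq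
  have hN₀le : N₀ ≤ ⌈δ₀ / δ⌉₊ := by
    have h1 : ((N₀ : ℝ) + 1) * δ < δ₀ := by
      have := (lt_div_iff₀ (by positivity : (0 : ℝ) < (N₀ : ℝ) + 1)).1 hδlt
      linarith [mul_comm δ ((N₀ : ℝ) + 1)]
    have h2 : (N₀ : ℝ) + 1 < δ₀ / δ := (lt_div_iff₀ hδpos).2 h1
    have h3 : (N₀ : ℝ) ≤ (⌈δ₀ / δ⌉₊ : ℝ) := by
      have := Nat.le_ceil (δ₀ / δ)
      linarith
    exact_mod_cast h3
  -- the dictionary at the aligned mesh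
  have hexact : bondDomainCrossingProb R (δ₀ / (⌈δ₀ / δ⌉₊ : ℝ)) =
      polygonWordAmplitude R (δ₀ / (⌈δ₀ / δ⌉₊ : ℝ)) :=
    RowTransferExactness_holds R δ₀ s ⌈δ₀ / δ⌉₊ hδ₀ hNpos hcar
  have hwN := hN₀ ⌈δ₀ / δ⌉₊ hN₀le
  rw [Real.dist_eq, ← hexact] at hwN
  rw [Real.dist_eq]
  calc |bondDomainCrossingProb R δ - cardyFunction (crossRatio x)|
        ≤ |bondDomainCrossingProb R δ - bondDomainCrossingProb R (δ₀ / (⌈δ₀ / δ⌉₊ : ℝ))| +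
          |bondDomainCrossingProb R (δ₀ / (⌈δ₀ / δ⌉₊ : ℝ)) - cardyFunction (crossRatio x)| :=
          abs_sub_le _ _ _
    _ < e / 2 + e / 2 := add_lt_add_of_le_of_lt hrδ hwN
    _ = e := by ring

end Summit.CriticalPhenomena.CardyFormulaZ2.Cruxes.CardyLatticePolygon.Birth

end
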